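import Literature.Probability.RandomPlanarGeometry.SLEKappaRhoDriving
import Literature.Probability.RandomPlanarGeometry.SLEPointFlow
import HarnessLib

/-!
# The asymmetry of SLE(8/3, ρ), ρ < 0 ([LSW] p. 38) in Schramm's coordinates: the left-passage observable and the conditional assembly

Level 6 of the decomposition of the named fact
`Literature.Probability.RandomPlanarGeometry.IsRestrictionMeasure.eq_five_eighths_of_simple`
(plan in `RestrictionMeasuresFiveEighths`, …, `SLEKappaRho`, `SLEKappaRhoAsymmetry`,
`SLEKappaRhoDriving`), for the named fact
`Literature.Probability.RandomPlanarGeometry.SLEKappaRho.measure_I_notMem_fill_lt_of_neg`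
(`SLEKappaRhoAsymmetry`), after

* G. F. Lawler, O. Schramm, W. Werner, *Conformal restriction: the chordal case*, J. Amer. Math.
  Soc. **16** (2003) 917–955, arXiv:math/0209343 (**[LSW]**), proof of Cor. 8.6 (p. 38):
  "Note that when `ρ < 0`, `W_t − √κ B_t` is decreasing. It follows easily that the probability
  that `i` ends up eventually to 'the right' of the right hand boundary of SLE(8/3, ρ) […] is
  strictly larger than the corresponding quantity for SLE(8/3, 0), which is `1/2` by symmetry."
* O. Schramm, *A percolation formula*, Electron. Comm. Probab. **6** (2001) 115–120,
  arXiv:math/0107096 (**[Sch]**): Lemma 3 ("`γ` is to the left of `z₀` if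
  `lim_{t↑τ(z₀)} w_t = ∞`", `w_t = x_t/y_t`, `x_t + i y_t = g_t(z₀) − W(t)`) and the proof of
  Thm. 2 (`h(w_u)` is a local martingale for the hitting function `h` of the diffusion
  `dw = −dW̃ + 4w du/(w² + 1)`; at `κ = 8/3`, `P[γ passes left of z₀] = ½ + x₀/(2|z₀|)`).
* S. Rohde, O. Schramm, *Basic properties of SLE*, Ann. of Math. **161** (2005), proof of
  Lemma 6.3, p. 905 (the localizing stopping times `tₙ ↑ τ(ẑ)`).

No proof of the second sentence is printed in [LSW]. The pathwise inclusion of the two events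
under `W ≤ √κ B` fails for general driving functions, so the sentence is read — as its wording
"ends up eventually to the right" suggests — in Schramm's coordinates: with
`S_t = (1 + cos arg(g_t(i) − W_t))/2 = h(w_t)`, `h(w) = (1 + w/√(1 + w²))/2` ([Sch] Thm. 2 at
`κ = 8/3`), `S` is a bounded local martingale for SLE_{8/3} (`E S = 1/2`), while for SLE(8/3, ρ),
`ρ < 0`, the extra drift `−ρ dt/Z_t ≥ 0` of `x_t` ([LSW]'s first sentence) adds the increasing
term `½ ∫ h'(w)(−ρ)/(Z y) dt`, so that `E S_∞ > 1/2`; and `S_t → 𝟙{i ∉ F^{ℝ₊}_ℍ(cl K_∞)}` by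
[Sch] Lemma 3. This file vendors that architecture:

* DEFINITIONS (pathwise, every driving function `W`): Schramm's function `schrammH`, the
  observable `Loewner.schrammObs W z t = (1 + Re z_t/|z_t|)/2` (`= h(w_t)` before `T_z`,
  `schrammObs_eq_schrammH`), the passage events `Loewner.PassesLeft W z` / `Loewner.PassesRight W z`
  (`w_t → ±∞` as `t ↑ T_z`, [Sch] Lemma 3, along the subtype of times before `T_z` as in
  `Loewner.tendsto_derivRatio_atTop_of_abs_cotArg_le`), the localizing times `Loewner.locTime W z n`
  (the pathwise form of `slePointLocTime`, `slePointLocTime_eq_locTime`; PROVED: `ρₙ < T_z`,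
  `ρₙ ≤ n + 1`, every `t < T_z` is eventually `≤ ρₙ`), the frozen observable
  `Loewner.schrammObsFrozen`, and for a driving PROCESS `W` the stopped observable
  `schrammObsStopped W z n = S_{· ∧ ρₙ}` (Mathlib `stoppedProcess`);
* PROVED, [LSW]'s first sentence: `SLEKappaRho.ae_antitone_snd_sub_of` — given the integrated
  Bessel equation (`SLEKappaRho.integral_inv_eq`), a.s. `t ↦ W_t − √κ B_t = ρ ∫₀ᵗ du/Z_u` is
  non-increasing for `ρ ≤ 0`;
* NO NAMED FACTS (D-0026): the four stochastic inputs of the second sentence appear as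
  explicit HYPOTHESES of the theorems that consume them — the dichotomy (a.s. `w_t → ±∞` as
  `t ↑ T_i` for SLE(8/3, ρ) pairs; [Sch] proof of Thm. 2), Schramm's Lemma 3 for SLE(8/3, ρ)
  (`w_t → +∞` iff `i ∉ F^{ℝ₊}_ℍ(cl K_∞)`), Schramm's martingale for SLE_{8/3} (`S_{· ∧ ρₙ}` is a
  martingale; the Itô step) and the comparison for `−2 < ρ < 0` (`E S_{t∧ρₙ} ≥ 1/2 + c`,
  `c > 0`; the Itô step with the Bessel drift). They are the intended statements of a future
  split of the target fact; nothing here asserts them;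
* PROVED, the conditional assembly: two dominated-convergence passages (`n → ∞`:
  `tendsto_integral_schrammObsStopped`, `S_{t∧ρₙ} → S̄_t` pathwise on the paths of the dichotomy,
  `Loewner.tendsto_schrammObs_min_locTime`; `t → ∞`: `tendsto_integral_schrammObsFrozen`,
  `S̄_t → 𝟙{passes left}`, `Loewner.tendsto_schrammObsFrozen_atTop`), whence, under the said
  hypotheses, `P[passes left of i] = 1/2` for SLE_{8/3} (`measureReal_passesLeft_sle_eq_half`),
  `> 1/2` for SLE(8/3, ρ), `ρ < 0` (`SLEKappaRho.half_lt_measureReal_passesLeft`), the comparison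
  for one pair of pairs (`SLEKappaRho.measure_I_notMem_fill_lt_of_schramm`), and the three named
  facts of `SLEKappaRho` / `SLEKappaRhoAsymmetry` as implications:
  `SLEKappaRho.measure_I_notMem_fill_lt_of_neg_of_schramm` (the target),
  `SLEKappaRho.one_half_lt_measure_I_notMem_fill_of_schramm` (the bundled p. 38 fact) and
  `SLEKappaRho.measure_I_notMem_fill_eq_half_of_schramm` (the symmetry sentence, here from
  Schramm's formula at `z₀ = i` rather than the reflection argument).

Not here: the Itô steps themselves (templates: `SLERSObservableIto`, `SLEPointFlowStopped` for
the driving function `√κ B`; the SLE(κ, ρ) driving function `√κ B + ρ ∫ du/Z` needs their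
generalization), and Schramm's Lemma 3 / the dichotomy for SLE(8/3, ρ), which rest on the fine
structure of the SLE(8/3, ρ) hulls (generated by a transient curve, simple in `ℍ`).

Mathlib: `MeasureTheory.stoppedProcess`, `MeasureTheory.hittingAfter`,
`MeasureTheory.tendsto_integral_of_dominated_convergence`, `aestronglyMeasurable_of_tendsto_ae`,
`MeasureTheory.Martingale.setIntegral_eq`, `MeasureTheory.integral_indicator_one`,
`MeasureTheory.NullMeasurableSet.exists_measurable_superset_ae_eq`. Tree: `Loewner.centredMap`,
`Loewner.cotArg`, `Loewner.imFlowStop` and its API (`LoewnerCotArgExit`, `LoewnerPointFlow`),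
`slePointLocTime` (`SLEPointFlow`), `Literature.Probability.Process.hittingAfter_zero_le_coe_iff`
(`ContinuousHitting`), `IsSLEKappaRhoPair`, `sleKappaRhoFill`, `SLEKappaRho.integral_inv_eq`,
`SLEKappaRho.ae_snd_eq_of`, `SLEKappaRho.ae_snd_eq_sleDriving_of` (`SLEKappaRho`,
`SLEKappaRhoRestriction`, `SLEKappaRhoDriving`).
-/

noncomputable section

open Set Filter Topology MeasureTheory Metric Complex
open scoped NNReal ENNReal
open Literature.Probability.Process (preWienerMeasure brownian)

namespace Literature.Probability.RandomPlanarGeometry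

/-! ### Schramm's left-passage function at `κ = 8/3` -/

/-- **Schramm's left-passage function at `κ = 8/3`**, `h(w) = (1 + w/√(1 + w²))/2`: the
probability that the SLE_{8/3} trace passes to the left of `z₀ = x₀ + i y₀`, as a function of
the slope `w = x₀/y₀` (Schramm (2001), Thm. 2: for `κ = 8/3` the right hand side
`½ + Γ(4/κ)/(√π Γ((8−κ)/(2κ))) (x₀/y₀) ₂F₁(½, 4/κ; 3/2; −x₀²/y₀²)` "simplifies to" `½ + x₀/(2|z₀|)`,
and `x₀/|z₀| = w/√(1 + w²)`). It is the increasing solution of Schramm's equation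
`(κ/2) h'' + (4w/(w² + 1)) h' = 0` with `h(−∞) = 0`, `h(+∞) = 1` at `κ = 8/3`
(`h' = ½ (1 + w²)^{−3/2}`). [cite: Schramm2001Percolation, Thm. 2 and its proof (eq. for h)] -/
def schrammH (w : ℝ) : ℝ := (1 + w / Real.sqrt (1 + w ^ 2)) / 2

/-- `|w| / √(1 + w²) < 1`, in the form `|w / √(1 + w²)| ≤ 1`. [folklore] -/
theorem abs_div_sqrt_one_add_sq_le (w : ℝ) : |w / Real.sqrt (1 + w ^ 2)| ≤ 1 := by
  have hs : 0 < Real.sqrt (1 + w ^ 2) := Real.sqrt_pos.2 (by positivity)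
  rw [abs_div, abs_of_pos hs, div_le_one hs]
  calc |w| = Real.sqrt (w ^ 2) := (Real.sqrt_sq_eq_abs w).symm
    _ ≤ Real.sqrt (1 + w ^ 2) := Real.sqrt_le_sqrt (by linarith)

/-- `0 ≤ h ≤ 1`. [folklore] -/
theorem schrammH_mem_Icc (w : ℝ) : schrammH w ∈ Icc (0 : ℝ) 1 := by
  have h := abs_le.1 (abs_div_sqrt_one_add_sq_le w)
  simp only [schrammH, mem_Icc]
  constructor <;> linarith [h.1, h.2]

/-- `h(0) = 1/2` (the value at `z₀ = i`). [cite: Schramm2001Percolation, Thm. 2] -/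
@[simp] theorem schrammH_zero : schrammH 0 = 1 / 2 := by simp [schrammH]

/-- `h(−w) = 1 − h(w)`. [folklore] -/
theorem schrammH_neg (w : ℝ) : schrammH (-w) = 1 - schrammH w := by
  simp only [schrammH, neg_div]
  ring

/-- `h` is continuous. [folklore] -/
theorem continuous_schrammH : Continuous schrammH := by
  unfold schrammH
  refine (continuous_const.add (continuous_id.div ?_ fun w ↦ ?_)).div_const _
  · exact Real.continuous_sqrt.comp (continuous_const.add (continuous_pow 2))
  · exact (Real.sqrt_pos.2 (by positivity)).ne'

/-- For `w ≥ 0`, `w/√(1 + w²) = √(1 − 1/(1 + w²))`. [folklore] -/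
theorem div_sqrt_one_add_sq_eq {w : ℝ} (hw : 0 ≤ w) :
    w / Real.sqrt (1 + w ^ 2) = Real.sqrt (1 - 1 / (1 + w ^ 2)) := by
  have h1 : 0 < 1 + w ^ 2 := by positivity
  have h2 : 1 - 1 / (1 + w ^ 2) = w ^ 2 / (1 + w ^ 2) := by field_simp; ring
  rw [h2, Real.sqrt_div (sq_nonneg w), Real.sqrt_sq hw]

/-- **`h(w) → 1` as `w → +∞`.** [cite: Schramm2001Percolation, Thm. 2 (proof)] -/
theorem tendsto_schrammH_atTop : Tendsto schrammH atTop (𝓝 1) := by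
  have h1 : Tendsto (fun w : ℝ ↦ 1 - 1 / (1 + w ^ 2)) atTop (𝓝 (1 - 0)) := by
    refine tendsto_const_nhds.sub ?_
    refine Tendsto.div_atTop tendsto_const_nhds ?_
    exact tendsto_atTop_add_const_left _ _ (tendsto_pow_atTop two_ne_zero)
  rw [sub_zero] at h1
  have h2 : Tendsto (fun w : ℝ ↦ Real.sqrt (1 - 1 / (1 + w ^ 2))) atTop (𝓝 1) := by
    have := (Real.continuous_sqrt.tendsto 1).comp h1
    rwa [Function.comp_def, Real.sqrt_one] at this
  have h3 : Tendsto (fun w : ℝ ↦ w / Real.sqrt (1 + w ^ 2)) atTop (𝓝 1) :=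
    h2.congr' ((eventually_ge_atTop 0).mono fun w hw ↦ (div_sqrt_one_add_sq_eq hw).symm)
  have h4 : Tendsto (fun w : ℝ ↦ (1 + w / Real.sqrt (1 + w ^ 2)) / 2) atTop (𝓝 ((1 + 1) / 2)) :=
    (tendsto_const_nhds.add h3).div_const 2
  norm_num at h4
  exact h4

/-- **`h(w) → 0` as `w → −∞`.** [cite: Schramm2001Percolation, Thm. 2 (proof)] -/
theorem tendsto_schrammH_atBot : Tendsto schrammH atBot (𝓝 0) := by
  have h1 : Tendsto (fun w : ℝ ↦ 1 - schrammH (-w)) atBot (𝓝 (1 - 1)) :=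
    tendsto_const_nhds.sub (tendsto_schrammH_atTop.comp tendsto_neg_atBot_atTop)
  rw [sub_self] at h1
  refine h1.congr fun w ↦ ?_
  rw [schrammH_neg, sub_sub_cancel]

namespace Loewner

variable {W : ℝ≥0 → ℝ} {z : ℂ}

/-! ### Schramm's observable `S_t = (1 + cos arg z_t)/2 = h(w_t)` along the centred flow -/

/-- **Schramm's left-passage observable** along the centred Loewner flow `z_t = g_t(z) − W_t`
of a driving function `W`: `S_t = (1 + Re z_t/|z_t|)/2 = (1 + cos arg z_t)/2 = h(w_t)`,
`w_t = x_t/y_t` (Schramm (2001), proof of Thm. 2 with Lemma 3: `h(w_u)` is a (local)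
martingale whose terminal value decides on which side of `z` the path passes; at `κ = 8/3`,
`h(w) = ½ + w/(2√(1 + w²))`). Always in `[0, 1]`; junk after the swallowing time (junk of
`Loewner.map`). [cite: Schramm2001Percolation, Thm. 2 (proof) and Lemma 3] -/
def schrammObs (W : ℝ≥0 → ℝ) (z : ℂ) (t : ℝ≥0) : ℝ :=
  (1 + (centredMap W t z).re / ‖centredMap W t z‖) / 2

/-- `0 ≤ S_t ≤ 1` (always: `|Re Z| ≤ |Z|`). [folklore] -/
theorem schrammObs_mem_Icc (W : ℝ≥0 → ℝ) (z : ℂ) (t : ℝ≥0) : schrammObs W z t ∈ Icc (0 : ℝ) 1 := by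
  have h : |(centredMap W t z).re / ‖centredMap W t z‖| ≤ 1 := by
    rcases eq_or_ne (centredMap W t z) 0 with h0 | h0
    · simp [h0]
    · rw [abs_div, abs_norm, div_le_one (norm_pos_iff.2 h0)]
      exact Complex.abs_re_le_norm _
  have h' := abs_le.1 h
  simp only [schrammObs, mem_Icc]
  constructor <;> linarith [h'.1, h'.2]

/-- `|S_t| ≤ 1`. [folklore] -/
theorem abs_schrammObs_le (W : ℝ≥0 → ℝ) (z : ℂ) (t : ℝ≥0) : |schrammObs W z t| ≤ 1 := by
  have h := schrammObs_mem_Icc W z t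
  rw [abs_le]
  exact ⟨by linarith [h.1], h.2⟩

/-- For `Im Z > 0`: `Re Z/|Z| = w/√(1 + w²)` with `w = Re Z/Im Z`. [folklore] -/
theorem re_div_norm_eq {Z : ℂ} (hZ : 0 < Z.im) :
    Z.re / ‖Z‖ = (Z.re / Z.im) / Real.sqrt (1 + (Z.re / Z.im) ^ 2) := by
  have hsq : Real.sqrt (1 + (Z.re / Z.im) ^ 2) = ‖Z‖ / Z.im := by
    rw [Real.sqrt_eq_iff_mul_self_eq (by positivity) (by positivity)]
    rw [Complex.norm_def, div_mul_div_comm, Real.mul_self_sqrt (Complex.normSq_nonneg Z),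
      Complex.normSq_apply]
    field_simp
    ring
  rw [hsq]
  have hn : ‖Z‖ ≠ 0 := norm_ne_zero_iff.2 fun h ↦ by rw [h, Complex.zero_im] at hZ; exact lt_irrefl _ hZ
  field_simp

/-- **`S_t = h(w_t)` before the swallowing time** (`Im z_t > 0`). [cite: Schramm2001Percolation, Thm. 2 (proof)] -/
theorem schrammObs_eq_schrammH (hW : Continuous W) (hz : 0 < z.im) {t : ℝ≥0}
    (ht : (t : WithTop ℝ≥0) < swallowingTime W z) :
    schrammObs W z t = schrammH (cotArg W z t) := by
  rw [schrammObs, schrammH, cotArg_apply, re_div_norm_eq (im_centredMap_pos hW hz ht)]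

/-- `S_0 = h(Re (z − W_0)/Im z)`; for `W_0 = 0` and `z = i` this is `1/2`. [folklore] -/
theorem schrammObs_zero (hW : Continuous W) (hz : 0 < z.im) :
    schrammObs W z 0 = schrammH ((z.re - W 0) / z.im) := by
  have hzW : z ≠ W 0 := ne_driving_of_im_pos hz 0
  have h0 : ((0 : ℝ≥0) : WithTop ℝ≥0) < swallowingTime W z := swallowingTime_pos_holds hW hzW
  rw [schrammObs_eq_schrammH hW hz h0, cotArg_apply, centredMap_zero hW hzW]
  simp

/-! ### "`γ` passes to the left of `z`": the limit of the slope `w_t` as `t ↑ T_z` -/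

/-- **"`γ` passes to the left of `z`"** for the Loewner chain driven by `W`, in Schramm's
dynamical form (Schramm (2001), Lemma 3: "Almost surely, `γ` is to the left [respectively,
right] of `z₀` if `lim_{t↑τ(z₀)} w_t = ∞` [respectively, `−∞`]", `w_t = x_t/y_t`,
`x_t + i y_t = g_t(z₀) − W(t)`): the slope `w_t` tends to `+∞` as `t ↑ T_z` (along the times
before the swallowing time `T_z ≤ ∞`, as in `tendsto_derivRatio_atTop_of_abs_cotArg_le`). For
[LSW] p. 38 with `z = i`: "`i` ends up eventually to 'the right' of the right hand boundary".
[cite: Schramm2001Percolation, Lemma 3] -/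
def PassesLeft (W : ℝ≥0 → ℝ) (z : ℂ) : Prop :=
  Tendsto (fun t : {t : ℝ≥0 // (t : WithTop ℝ≥0) < swallowingTime W z} ↦ cotArg W z t) atTop atTop

/-- **"`γ` passes to the right of `z`"**: `w_t → −∞` as `t ↑ T_z` (Schramm (2001), Lemma 3).
[cite: Schramm2001Percolation, Lemma 3] -/
def PassesRight (W : ℝ≥0 → ℝ) (z : ℂ) : Prop :=
  Tendsto (fun t : {t : ℝ≥0 // (t : WithTop ℝ≥0) < swallowingTime W z} ↦ cotArg W z t) atTop atBot

/-- The time `0` is before the swallowing time of a point of `ℍ` (continuous driving function).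
[folklore] -/
theorem coe_zero_lt_swallowingTime (hW : Continuous W) (hz : 0 < z.im) :
    ((0 : ℝ≥0) : WithTop ℝ≥0) < swallowingTime W z :=
  swallowingTime_pos_holds hW (ne_driving_of_im_pos hz 0)

/-- The two passage events exclude each other (the filter of times before `T_z` is
non-trivial). [folklore] -/
theorem PassesLeft.not_passesRight (hW : Continuous W) (hz : 0 < z.im) (h : PassesLeft W z) :
    ¬ PassesRight W z := by
  intro h'
  haveI : Nonempty {t : ℝ≥0 // (t : WithTop ℝ≥0) < swallowingTime W z} :=
    ⟨⟨0, coe_zero_lt_swallowingTime hW hz⟩⟩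
  have h1 : ∀ᶠ t : {t : ℝ≥0 // (t : WithTop ℝ≥0) < swallowingTime W z} in atTop,
      (1 : ℝ) ≤ cotArg W z t := h.eventually (eventually_ge_atTop 1)
  have h2 : ∀ᶠ t : {t : ℝ≥0 // (t : WithTop ℝ≥0) < swallowingTime W z} in atTop,
      cotArg W z t ≤ 0 := h'.eventually (eventually_le_atBot 0)
  obtain ⟨t, ht1, ht2⟩ := (h1.and h2).exists
  linarith


/-! ### The localizing times `ρₙ` of the flow of a point, for an arbitrary driving function -/

/-- **The localizing times `ρₙ = Hₙ ∧ Sₙ ∧ (n+1)`** of the flow of `z` under the driving function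
`W` (pathwise form of `slePointLocTime`, which is the case `W = √κ B(ω)`,
`slePointLocTime_eq_locTime`): `Hₙ` is the first time the frozen imaginary part `y_t`
(`imFlowStop`) is `≤ Im z/(n+2)`, `Sₙ` the first time `|W_t| ≥ n + 1`. Before `ρₙ` the flow is
alive with `y ≥ Im z/(n+2)` and `|W| ≤ n + 1` — Rohde–Schramm's "increasing sequence of stopping
times `tₙ < τ(ẑ)` with `limₙ tₙ = τ(ẑ)`" (Ann. Math. 161 (2005), p. 905), along which all
coefficients of the Itô calculus of `z_t` stay bounded. Hitting times are Mathlib's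
`MeasureTheory.hittingAfter` on the path space. [cite: RohdeSchramm2005, Lemma 6.3 (proof, p. 905)] -/
def locTime (W : ℝ≥0 → ℝ) (z : ℂ) (n : ℕ) : WithTop ℝ≥0 :=
  min (hittingAfter (fun t (U : ℝ≥0 → ℝ) ↦ imFlowStop U z t) (Iic (z.im / (n + 2))) 0 W)
    (min (hittingAfter (fun t (U : ℝ≥0 → ℝ) ↦ |U t|) (Ici ((n : ℝ) + 1)) 0 W)
      (((n : ℝ≥0) + 1 : ℝ≥0) : WithTop ℝ≥0))

/-- The SLE_κ localizing times of `SLEPointFlow` are the pathwise ones of the driving function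
`√κ B(ω)`. [folklore] -/
theorem _root_.Literature.Probability.RandomPlanarGeometry.slePointLocTime_eq_locTime
    (κ : ℝ≥0) (z : ℂ) (n : ℕ) (ω : ℝ≥0 → ℝ) :
    slePointLocTime κ z n ω = locTime (sleDriving κ ω) z n := rfl

/-- `ρₙ ≤ n + 1`. [folklore] -/
theorem locTime_le (W : ℝ≥0 → ℝ) (z : ℂ) (n : ℕ) :
    locTime W z n ≤ (((n : ℝ≥0) + 1 : ℝ≥0) : WithTop ℝ≥0) :=
  (min_le_right _ _).trans (min_le_right _ _)

/-- `ρₙ < ⊤`. [folklore] -/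
theorem locTime_ne_top (W : ℝ≥0 → ℝ) (z : ℂ) (n : ℕ) : locTime W z n ≠ ⊤ :=
  ne_top_of_le_ne_top WithTop.coe_ne_top (locTime_le W z n)

/-- **`ρₙ < T_z`** (`W` continuous, `Im z > 0`): at a finite swallowing time the frozen
imaginary part drops below every positive level strictly before it. [cite: RohdeSchramm2005, Lemma 6.3 (proof, p. 905)] -/
theorem locTime_lt_swallowingTime (hW : Continuous W) (hz : 0 < z.im) (n : ℕ) :
    locTime W z n < swallowingTime W z := by
  induction hT : swallowingTime W z using WithTop.recTopCoe with
  | top => exact lt_of_le_of_lt (locTime_le W z n) (WithTop.coe_lt_top _)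
  | coe b =>
    have hlev : 0 < z.im / (n + 2) := by positivity
    obtain ⟨s, hsb, hs⟩ := imFlowStop_lt_of_near_swallowingTime hW hz hT hlev
    have hmem : (fun t (U : ℝ≥0 → ℝ) ↦ imFlowStop U z t) s W ∈ Iic (z.im / (n + 2)) :=
      (hs s le_rfl hsb).le
    have hH : hittingAfter (fun t (U : ℝ≥0 → ℝ) ↦ imFlowStop U z t) (Iic (z.im / (n + 2))) 0 W ≤ s :=
      hittingAfter_le_of_mem bot_le hmem
    exact lt_of_le_of_lt ((min_le_left _ _).trans hH) (WithTop.coe_lt_coe.2 hsb)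

/-- **Exhaustion: every time `t < T_z` is `≤ ρₙ` for all large `n`** (`y` is bounded below on
`[0, t]` by `y_t > 0` and `W` is bounded on `[0, t]`). [cite: RohdeSchramm2005, Lemma 6.3 (proof, p. 905)] -/
theorem exists_le_locTime (hW : Continuous W) (hz : 0 < z.im) {t : ℝ≥0}
    (ht : (t : WithTop ℝ≥0) < swallowingTime W z) :
    ∃ N : ℕ, ∀ n, N ≤ n → (t : WithTop ℝ≥0) ≤ locTime W z n := by
  have hyt : 0 < imFlowStop W z t := (imFlowStop_pos_iff hW hz).2 ht
  have hy : ∀ s : ℝ≥0, s ≤ t → imFlowStop W z t ≤ imFlowStop W z s := fun s hs ↦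
    imFlowStop_antitone hW hz hs
  obtain ⟨C, hC⟩ : ∃ C, ∀ s ∈ Icc (0 : ℝ≥0) t, |W s| ≤ C := by
    obtain ⟨C, hC⟩ := isCompact_Icc.exists_bound_of_continuousOn (hW.continuousOn (s := Icc 0 t))
    exact ⟨C, fun s hs ↦ by simpa [Real.norm_eq_abs] using hC s hs⟩
  obtain ⟨N₁, hN₁⟩ := exists_nat_gt (z.im / imFlowStop W z t)
  obtain ⟨N₂, hN₂⟩ := exists_nat_gt (max C (t : ℝ))
  refine ⟨max N₁ N₂, fun n hn ↦ ?_⟩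
  have hn₁ : (N₁ : ℝ) ≤ n := by exact_mod_cast (le_max_left _ _).trans hn
  have hn₂ : (N₂ : ℝ) ≤ n := by exact_mod_cast (le_max_right _ _).trans hn
  have hlevel : z.im / (n + 2) < imFlowStop W z t := by
    rw [div_lt_iff₀ (by positivity)]
    have h1 : z.im / imFlowStop W z t < n + 2 := by linarith
    rw [div_lt_iff₀ hyt] at h1
    linarith
  have hCn : C < n + 1 := by linarith [le_max_left C (t : ℝ)]
  have htn : (t : ℝ) < n + 1 := by linarith [le_max_right C (t : ℝ)]
  simp only [locTime]
  refine le_min ?_ (le_min ?_ ?_)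
  · by_contra hlt
    rw [not_le] at hlt
    obtain ⟨j, hjt, hj⟩ := (Process.hittingAfter_zero_le_coe_iff
      (u := fun t (U : ℝ≥0 → ℝ) ↦ imFlowStop U z t) isClosed_Iic
      (continuous_imFlowStop hW hz)).1 hlt.le
    exact absurd ((hy j hjt).trans (mem_Iic.1 hj)) (not_le.2 hlevel)
  · by_contra hlt
    rw [not_le] at hlt
    obtain ⟨j, hjt, hj⟩ := (Process.hittingAfter_zero_le_coe_iff
      (u := fun t (U : ℝ≥0 → ℝ) ↦ |U t|) isClosed_Ici hW.abs).1 hlt.le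
    have := hC j ⟨bot_le, hjt⟩
    exact absurd ((mem_Ici.1 hj).trans this) (not_le.2 hCn)
  · exact_mod_cast htn.le

/-- The localizing times, read in `ℝ≥0`, tend to the swallowing time from below: for every
`s < T_z`, eventually `s ≤ ρₙ`. In particular the sequence `n ↦ ρₙ` tends to `atTop` in the
ordered set of times before `T_z`. [cite: RohdeSchramm2005, Lemma 6.3 (proof, p. 905)] -/
theorem tendsto_locTime_atTop (hW : Continuous W) (hz : 0 < z.im) :
    Tendsto (fun n : ℕ ↦ (⟨(locTime W z n).untop (locTime_ne_top W z n),
        by rw [WithTop.coe_untop]; exact locTime_lt_swallowingTime hW hz n⟩ :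
      {t : ℝ≥0 // (t : WithTop ℝ≥0) < swallowingTime W z})) atTop atTop := by
  haveI : Nonempty {t : ℝ≥0 // (t : WithTop ℝ≥0) < swallowingTime W z} :=
    ⟨⟨0, coe_zero_lt_swallowingTime hW hz⟩⟩
  rw [tendsto_atTop_atTop]
  intro s
  obtain ⟨N, hN⟩ := exists_le_locTime hW hz s.2
  refine ⟨N, fun n hn ↦ ?_⟩
  change (s : ℝ≥0) ≤ (locTime W z n).untop (locTime_ne_top W z n)
  rw [← WithTop.coe_le_coe, WithTop.coe_untop]
  exact hN n hn

/-! ### The observable frozen at the swallowing time, and its two limits -/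

/-- The observable **frozen at the swallowing time**: `S_t` for `t < T_z`, and from `T_z` on the
terminal value `1` if the path passes to the left of `z` and `0` otherwise (on the paths of
Schramm's Lemma 3, where `w_t → ±∞` as `t ↑ T_z`, this is the limit of `S` at `T_z−`).
[cite: Schramm2001Percolation, Lemma 3] -/
def schrammObsFrozen (W : ℝ≥0 → ℝ) (z : ℂ) (t : ℝ≥0) : ℝ :=
  open scoped Classical in
  if (t : WithTop ℝ≥0) < swallowingTime W z then schrammObs W z t
  else if PassesLeft W z then 1 else 0

/-- `0 ≤ S̄_t ≤ 1`. [folklore] -/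
theorem schrammObsFrozen_mem_Icc (W : ℝ≥0 → ℝ) (z : ℂ) (t : ℝ≥0) :
    schrammObsFrozen W z t ∈ Icc (0 : ℝ) 1 := by
  unfold schrammObsFrozen
  split_ifs
  · exact schrammObs_mem_Icc W z t
  · exact ⟨zero_le_one, le_rfl⟩
  · exact ⟨le_rfl, zero_le_one⟩

/-- `|S̄_t| ≤ 1`. [folklore] -/
theorem abs_schrammObsFrozen_le (W : ℝ≥0 → ℝ) (z : ℂ) (t : ℝ≥0) : |schrammObsFrozen W z t| ≤ 1 := by
  have h := schrammObsFrozen_mem_Icc W z t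
  rw [abs_le]
  exact ⟨by linarith [h.1], h.2⟩

/-- Along the localizing times the observable tends to the terminal value, on a path passing
to the left of `z`: `S_{ρₙ} = h(w_{ρₙ}) → 1`. [cite: Schramm2001Percolation, Lemma 3] -/
theorem tendsto_schrammObs_locTime_of_passesLeft (hW : Continuous W) (hz : 0 < z.im)
    (h : PassesLeft W z) :
    Tendsto (fun n : ℕ ↦ schrammObs W z ((locTime W z n).untop (locTime_ne_top W z n)))
      atTop (𝓝 1) := by
  have h1 := (tendsto_schrammH_atTop.comp h).comp (tendsto_locTime_atTop hW hz)
  refine h1.congr fun n ↦ ?_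
  simp only [Function.comp_apply]
  rw [schrammObs_eq_schrammH hW hz]
  rw [WithTop.coe_untop]
  exact locTime_lt_swallowingTime hW hz n

/-- … and on a path passing to the right of `z`: `S_{ρₙ} → 0`. [cite: Schramm2001Percolation, Lemma 3] -/
theorem tendsto_schrammObs_locTime_of_passesRight (hW : Continuous W) (hz : 0 < z.im)
    (h : PassesRight W z) :
    Tendsto (fun n : ℕ ↦ schrammObs W z ((locTime W z n).untop (locTime_ne_top W z n)))
      atTop (𝓝 0) := by
  have h1 := (tendsto_schrammH_atBot.comp h).comp (tendsto_locTime_atTop hW hz)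
  refine h1.congr fun n ↦ ?_
  simp only [Function.comp_apply]
  rw [schrammObs_eq_schrammH hW hz]
  rw [WithTop.coe_untop]
  exact locTime_lt_swallowingTime hW hz n

/-- **The stopped observable tends to the frozen one as the localization is removed**: for every
`t`, `S_{t ∧ ρₙ} → S̄_t` as `n → ∞`, on every path where `w_t → ±∞` as `t ↑ T_z` (if `t < T_z`
the clocks `t ∧ ρₙ` are eventually `t`; otherwise `t ∧ ρₙ = ρₙ ↑ T_z`). The stopped clock is
written exactly as in `MeasureTheory.stoppedProcess`. [cite: Schramm2001Percolation, Lemma 3] -/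
theorem tendsto_schrammObs_min_locTime (hW : Continuous W) (hz : 0 < z.im)
    (h : PassesLeft W z ∨ PassesRight W z) (t : ℝ≥0) :
    Tendsto (fun n : ℕ ↦ schrammObs W z (min (t : WithTop ℝ≥0) (locTime W z n)).untopA)
      atTop (𝓝 (schrammObsFrozen W z t)) := by
  by_cases ht : (t : WithTop ℝ≥0) < swallowingTime W z
  · -- eventually the clock is `t`
    rw [schrammObsFrozen, if_pos ht]
    obtain ⟨N, hN⟩ := exists_le_locTime hW hz ht
    refine tendsto_const_nhds.congr' ?_
    filter_upwards [eventually_ge_atTop N] with n hn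
    rw [min_eq_left (hN n hn), WithTop.untopA_eq_untop WithTop.coe_ne_top, WithTop.untop_coe]
  · -- the clock is `ρₙ ↑ T_z`
    have hclock : ∀ n, (min (t : WithTop ℝ≥0) (locTime W z n)).untopA =
        (locTime W z n).untop (locTime_ne_top W z n) := fun n ↦ by
      have hle : locTime W z n ≤ (t : WithTop ℝ≥0) :=
        ((locTime_lt_swallowingTime hW hz n).trans_le (not_lt.1 ht)).le
      rw [min_eq_right hle, WithTop.untopA_eq_untop (locTime_ne_top W z n)]
    simp only [hclock]
    rcases h with hL | hR
    · rw [schrammObsFrozen, if_neg ht, if_pos hL]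
      exact tendsto_schrammObs_locTime_of_passesLeft hW hz hL
    · rw [schrammObsFrozen, if_neg ht, if_neg (fun hL : PassesLeft W z ↦ hL.not_passesRight hW hz hR)]
      exact tendsto_schrammObs_locTime_of_passesRight hW hz hR

/-- A limit `w_t → +∞` along the times before `T_z = ∞` is a limit along `atTop` of `ℝ≥0`.
[folklore] -/
theorem tendsto_cotArg_atTop_of_top (h : PassesLeft W z) (hT : swallowingTime W z = ⊤) :
    Tendsto (cotArg W z) atTop atTop := by
  haveI : Nonempty {t : ℝ≥0 // (t : WithTop ℝ≥0) < swallowingTime W z} :=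
    ⟨⟨0, by rw [hT]; exact WithTop.coe_lt_top 0⟩⟩
  rw [PassesLeft, tendsto_atTop_atTop] at h
  rw [tendsto_atTop_atTop]
  intro b
  obtain ⟨i, hi⟩ := h b
  refine ⟨i, fun a ha ↦ ?_⟩
  exact hi ⟨a, by rw [hT]; exact WithTop.coe_lt_top a⟩ ha

/-- A limit `w_t → −∞` along the times before `T_z = ∞` is a limit along `atTop` of `ℝ≥0`.
[folklore] -/
theorem tendsto_cotArg_atBot_of_top (h : PassesRight W z) (hT : swallowingTime W z = ⊤) :
    Tendsto (cotArg W z) atTop atBot := by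
  haveI : Nonempty {t : ℝ≥0 // (t : WithTop ℝ≥0) < swallowingTime W z} :=
    ⟨⟨0, by rw [hT]; exact WithTop.coe_lt_top 0⟩⟩
  rw [PassesRight, tendsto_atTop_atBot] at h
  rw [tendsto_atTop_atBot]
  intro b
  obtain ⟨i, hi⟩ := h b
  refine ⟨i, fun a ha ↦ ?_⟩
  exact hi ⟨a, by rw [hT]; exact WithTop.coe_lt_top a⟩ ha

/-- **The frozen observable tends to the passage indicator as `t → ∞`**: `S̄_t → 1` on a path
passing to the left of `z`, `→ 0` on a path passing to the right (if `T_z = ∞` this is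
`h(w_t) → h(±∞)`; if `T_z < ∞` the frozen observable is eventually the terminal value).
[cite: Schramm2001Percolation, Lemma 3] -/
theorem tendsto_schrammObsFrozen_atTop [Decidable (PassesLeft W z)] (hW : Continuous W) (hz : 0 < z.im)
    (h : PassesLeft W z ∨ PassesRight W z) :
    Tendsto (schrammObsFrozen W z) atTop (𝓝 (if PassesLeft W z then 1 else 0)) := by
  induction hT : swallowingTime W z using WithTop.recTopCoe with
  | top =>
    have heq : schrammObsFrozen W z = fun t ↦ schrammH (cotArg W z t) := by
      funext t
      have ht : (t : WithTop ℝ≥0) < swallowingTime W z := by rw [hT]; exact WithTop.coe_lt_top t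
      rw [schrammObsFrozen, if_pos ht, schrammObs_eq_schrammH hW hz ht]
    rw [heq]
    rcases h with hL | hR
    · rw [if_pos hL]
      exact tendsto_schrammH_atTop.comp (tendsto_cotArg_atTop_of_top hL hT)
    · rw [if_neg (fun hL : PassesLeft W z ↦ hL.not_passesRight hW hz hR)]
      exact tendsto_schrammH_atBot.comp (tendsto_cotArg_atBot_of_top hR hT)
  | coe b =>
    refine tendsto_const_nhds.congr' ?_
    filter_upwards [eventually_ge_atTop b] with t ht
    have hnot : ¬ (t : WithTop ℝ≥0) < swallowingTime W z := by
      rw [hT, not_lt]; exact_mod_cast ht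
    rw [schrammObsFrozen, if_neg hnot]
    split_ifs <;> rfl

end Loewner

/-! ### The stopped observable of a driving process, and the two dominated-convergence steps -/

section Process

variable {W : ℝ≥0 → (ℝ≥0 → ℝ) → ℝ} {z : ℂ}

/-- For a driving PROCESS `W` on the canonical space (time first, as all processes of the
tree's Itô calculus; e.g. `W t ω = √κ B_t(ω)` for SLE_κ, or the `W` of an SLE(κ, ρ) driving pair)
and a point `z`: **Schramm's observable of the chain driven by the path `s ↦ W s ω`, stopped at
the localizing time `ρₙ` of that path**, `(t, ω) ↦ S_{t ∧ ρₙ(ω)}(ω)` (Mathlib's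
`MeasureTheory.stoppedProcess`). This is the process whose expectation the optional stopping
theorem evaluates ("`M_{t∧tₙ}` is a martingale", Rohde–Schramm (2005), p. 905; Schramm (2001),
proof of Thm. 2: "`h(w_u)` is a local martingale"). [cite: Schramm2001Percolation, Thm. 2 (proof)] -/
def schrammObsStopped (W : ℝ≥0 → (ℝ≥0 → ℝ) → ℝ) (z : ℂ) (n : ℕ) : ℝ≥0 → (ℝ≥0 → ℝ) → ℝ :=
  stoppedProcess (fun t ω ↦ Loewner.schrammObs (fun s ↦ W s ω) z t)
    (fun ω ↦ Loewner.locTime (fun s ↦ W s ω) z n)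

/-- Unfolding of the stopped observable. [folklore] -/
theorem schrammObsStopped_apply (W : ℝ≥0 → (ℝ≥0 → ℝ) → ℝ) (z : ℂ) (n : ℕ) (t : ℝ≥0)
    (ω : ℝ≥0 → ℝ) :
    schrammObsStopped W z n t ω = Loewner.schrammObs (fun s ↦ W s ω) z
      (min (t : WithTop ℝ≥0) (Loewner.locTime (fun s ↦ W s ω) z n)).untopA := rfl

/-- `|S_{t ∧ ρₙ}| ≤ 1`. [folklore] -/
theorem abs_schrammObsStopped_le (W : ℝ≥0 → (ℝ≥0 → ℝ) → ℝ) (z : ℂ) (n : ℕ) (t : ℝ≥0)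
    (ω : ℝ≥0 → ℝ) : |schrammObsStopped W z n t ω| ≤ 1 :=
  Loewner.abs_schrammObs_le _ _ _

/-- **First dominated-convergence step** (`n → ∞`, `t` fixed): if almost every path of `W` is
continuous with `w_t → ±∞` as `t ↑ T_z`, and the stopped observables are events' worth of
measurable, then `E[S_{t ∧ ρₙ}] → E[S̄_t]`. [folklore] -/
theorem tendsto_integral_schrammObsStopped (hz : 0 < z.im)
    (hc : ∀ᵐ ω ∂preWienerMeasure, Continuous fun s ↦ W s ω)
    (hd : ∀ᵐ ω ∂preWienerMeasure,
      Loewner.PassesLeft (fun s ↦ W s ω) z ∨ Loewner.PassesRight (fun s ↦ W s ω) z)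
    (hm : ∀ n t, AEStronglyMeasurable (schrammObsStopped W z n t) preWienerMeasure) (t : ℝ≥0) :
    Tendsto (fun n : ℕ ↦ ∫ ω, schrammObsStopped W z n t ω ∂preWienerMeasure) atTop
      (𝓝 (∫ ω, Loewner.schrammObsFrozen (fun s ↦ W s ω) z t ∂preWienerMeasure)) := by
  haveI : IsProbabilityMeasure preWienerMeasure := isProbabilityMeasure_preWienerMeasure'
  refine tendsto_integral_of_dominated_convergence (fun _ ↦ (1 : ℝ)) (fun n ↦ hm n t)
    (integrable_const 1) (fun n ↦ ae_of_all _ fun ω ↦ ?_) ?_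
  · rw [Real.norm_eq_abs]
    exact abs_schrammObsStopped_le W z n t ω
  · filter_upwards [hc, hd] with ω hω hω'
    exact Loewner.tendsto_schrammObs_min_locTime hω hz hω' t

/-- The frozen observable at each time is then a.e. strongly measurable (an a.e. limit).
[folklore] -/
theorem aestronglyMeasurable_schrammObsFrozen (hz : 0 < z.im)
    (hc : ∀ᵐ ω ∂preWienerMeasure, Continuous fun s ↦ W s ω)
    (hd : ∀ᵐ ω ∂preWienerMeasure,
      Loewner.PassesLeft (fun s ↦ W s ω) z ∨ Loewner.PassesRight (fun s ↦ W s ω) z)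
    (hm : ∀ n t, AEStronglyMeasurable (schrammObsStopped W z n t) preWienerMeasure) (t : ℝ≥0) :
    AEStronglyMeasurable (fun ω ↦ Loewner.schrammObsFrozen (fun s ↦ W s ω) z t) preWienerMeasure := by
  refine aestronglyMeasurable_of_tendsto_ae atTop (fun n ↦ hm n t) ?_
  filter_upwards [hc, hd] with ω hω hω'
  exact Loewner.tendsto_schrammObs_min_locTime hω hz hω' t

open scoped Classical in
/-- **Second dominated-convergence step** (`t → ∞` along the integers): `E[S̄_t]` tends to the
expectation of the passage indicator. [folklore] -/
theorem tendsto_integral_schrammObsFrozen (hz : 0 < z.im)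
    (hc : ∀ᵐ ω ∂preWienerMeasure, Continuous fun s ↦ W s ω)
    (hd : ∀ᵐ ω ∂preWienerMeasure,
      Loewner.PassesLeft (fun s ↦ W s ω) z ∨ Loewner.PassesRight (fun s ↦ W s ω) z)
    (hm : ∀ n t, AEStronglyMeasurable (schrammObsStopped W z n t) preWienerMeasure) :
    Tendsto (fun k : ℕ ↦ ∫ ω, Loewner.schrammObsFrozen (fun s ↦ W s ω) z (k : ℝ≥0) ∂preWienerMeasure)
      atTop (𝓝 (∫ ω, (if Loewner.PassesLeft (fun s ↦ W s ω) z then (1 : ℝ) else 0) ∂preWienerMeasure)) := by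
  haveI : IsProbabilityMeasure preWienerMeasure := isProbabilityMeasure_preWienerMeasure'
  refine tendsto_integral_of_dominated_convergence (fun _ ↦ (1 : ℝ))
    (fun k ↦ aestronglyMeasurable_schrammObsFrozen hz hc hd hm _)
    (integrable_const 1) (fun k ↦ ae_of_all _ fun ω ↦ ?_) ?_
  · rw [Real.norm_eq_abs]
    exact Loewner.abs_schrammObsFrozen_le _ z _
  · filter_upwards [hc, hd] with ω hω hω'
    exact (Loewner.tendsto_schrammObsFrozen_atTop hω hz hω').comp tendsto_natCast_atTop_atTop

open scoped Classical in
/-- The expectation of the passage indicator is the probability of the passage event (the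
indicator is an a.e. limit of a.e. strongly measurable functions, so the event is
null-measurable). [folklore] -/
theorem integral_passesLeft_indicator (hz : 0 < z.im)
    (hc : ∀ᵐ ω ∂preWienerMeasure, Continuous fun s ↦ W s ω)
    (hd : ∀ᵐ ω ∂preWienerMeasure,
      Loewner.PassesLeft (fun s ↦ W s ω) z ∨ Loewner.PassesRight (fun s ↦ W s ω) z)
    (hm : ∀ n t, AEStronglyMeasurable (schrammObsStopped W z n t) preWienerMeasure) :
    ∫ ω, (if Loewner.PassesLeft (fun s ↦ W s ω) z then (1 : ℝ) else 0) ∂preWienerMeasure =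
      preWienerMeasure.real {ω | Loewner.PassesLeft (fun s ↦ W s ω) z} := by
  haveI : IsProbabilityMeasure preWienerMeasure := isProbabilityMeasure_preWienerMeasure'
  set A : Set (ℝ≥0 → ℝ) := {ω | Loewner.PassesLeft (fun s ↦ W s ω) z} with hA
  have hind : (fun ω ↦ (if Loewner.PassesLeft (fun s ↦ W s ω) z then (1 : ℝ) else 0)) =
      A.indicator 1 := by
    funext ω
    simp only [hA, Set.indicator_apply, mem_setOf_eq, Pi.one_apply]
  -- the indicator is an a.e. limit, hence a.e. strongly measurable
  have hg : AEStronglyMeasurable (A.indicator (1 : (ℝ≥0 → ℝ) → ℝ)) preWienerMeasure := by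
    rw [← hind]
    refine aestronglyMeasurable_of_tendsto_ae atTop
      (fun k : ℕ ↦ aestronglyMeasurable_schrammObsFrozen hz hc hd hm (k : ℝ≥0)) ?_
    filter_upwards [hc, hd] with ω hω hω'
    exact (Loewner.tendsto_schrammObsFrozen_atTop hω hz hω').comp tendsto_natCast_atTop_atTop
  have hA0 : NullMeasurableSet A preWienerMeasure := by
    have h1 : (A.indicator (1 : (ℝ≥0 → ℝ) → ℝ)) ⁻¹' {1} = A := by
      ext ω
      by_cases hω : ω ∈ A <;> simp [hω]
    rw [← h1]
    exact hg.aemeasurable.nullMeasurable (measurableSet_singleton 1)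
  obtain ⟨A', -, hA'm, hA'A⟩ := hA0.exists_measurable_superset_ae_eq
  rw [hind, integral_congr_ae (indicator_ae_eq_of_ae_eq_set hA'A.symm), integral_indicator_one hA'm,
    measureReal_congr hA'A]

/-- **The probability of left passage as a double limit**: if for every `t` the expectations
`E[S_{t ∧ ρₙ}]` are eventually (in `n`) equal to `v`, then `P[γ passes left of z] = v`.
[cite: Schramm2001Percolation, Thm. 2 (proof)] -/
theorem measureReal_passesLeft_eq (hz : 0 < z.im)
    (hc : ∀ᵐ ω ∂preWienerMeasure, Continuous fun s ↦ W s ω)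
    (hd : ∀ᵐ ω ∂preWienerMeasure,
      Loewner.PassesLeft (fun s ↦ W s ω) z ∨ Loewner.PassesRight (fun s ↦ W s ω) z)
    (hm : ∀ n t, AEStronglyMeasurable (schrammObsStopped W z n t) preWienerMeasure) {v : ℝ}
    (hv : ∀ t : ℝ≥0, ∀ᶠ n : ℕ in atTop, ∫ ω, schrammObsStopped W z n t ω ∂preWienerMeasure = v) :
    preWienerMeasure.real {ω | Loewner.PassesLeft (fun s ↦ W s ω) z} = v := by
  classical
  have h1 : ∀ t : ℝ≥0, ∫ ω, Loewner.schrammObsFrozen (fun s ↦ W s ω) z t ∂preWienerMeasure = v :=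
    fun t ↦ tendsto_nhds_unique (tendsto_integral_schrammObsStopped hz hc hd hm t)
      (tendsto_const_nhds.congr' ((hv t).mono fun n hn ↦ hn.symm))
  have h2 := tendsto_integral_schrammObsFrozen hz hc hd hm
  simp only [h1] at h2
  rw [← integral_passesLeft_indicator hz hc hd hm]
  exact tendsto_nhds_unique h2 tendsto_const_nhds

/-- **Lower bound**: if for all large `t` the expectations `E[S_{t ∧ ρₙ}]` are eventually (in
`n`) at least `v`, then `P[γ passes left of z] ≥ v`. [cite: Schramm2001Percolation, Thm. 2 (proof)] -/
theorem le_measureReal_passesLeft (hz : 0 < z.im)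
    (hc : ∀ᵐ ω ∂preWienerMeasure, Continuous fun s ↦ W s ω)
    (hd : ∀ᵐ ω ∂preWienerMeasure,
      Loewner.PassesLeft (fun s ↦ W s ω) z ∨ Loewner.PassesRight (fun s ↦ W s ω) z)
    (hm : ∀ n t, AEStronglyMeasurable (schrammObsStopped W z n t) preWienerMeasure) {v : ℝ}
    (hv : ∀ᶠ t : ℝ≥0 in atTop, ∀ᶠ n : ℕ in atTop,
      v ≤ ∫ ω, schrammObsStopped W z n t ω ∂preWienerMeasure) :
    v ≤ preWienerMeasure.real {ω | Loewner.PassesLeft (fun s ↦ W s ω) z} := by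
  classical
  have h1 : ∀ᶠ t : ℝ≥0 in atTop,
      v ≤ ∫ ω, Loewner.schrammObsFrozen (fun s ↦ W s ω) z t ∂preWienerMeasure :=
    hv.mono fun t ht ↦ ge_of_tendsto (tendsto_integral_schrammObsStopped hz hc hd hm t) ht
  have h2 := tendsto_integral_schrammObsFrozen hz hc hd hm
  rw [integral_passesLeft_indicator hz hc hd hm] at h2
  exact ge_of_tendsto h2 (tendsto_natCast_atTop_atTop.eventually h1)

end Process

/-! ### [LSW] p. 38, first sentence: `W_t − √κ B_t` is non-increasing for `ρ ≤ 0` -/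

/-- **"Note that when `ρ < 0`, `W_t − √κ B_t` is decreasing"** ([LSW] proof of Cor. 8.6,
p. 38, first sentence), PROVED from the integrated Bessel equation of §8.3
(`SLEKappaRho.integral_inv_eq`): a.s. `W_t − √κ B_t = ρ ∫₀ᵗ du/Z_u` for all `t`
(`SLEKappaRho.ae_snd_eq_of`), and `t ↦ ∫₀ᵗ du/Z_u` is non-decreasing because `Z = W − O ≥ 0`
and `1/Z` is integrable on every `[0, t]`; so for `ρ ≤ 0` the difference is non-increasing
("decreasing" in the wide sense; for `ρ = 0` it vanishes).
[cite: LawlerSchrammWerner2003Restriction, proof of Cor. 8.6 (p. 38), first sentence] -/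
theorem SLEKappaRho.ae_antitone_snd_sub_of (h : SLEKappaRho.integral_inv_eq) {κ : ℝ≥0} {ρ : ℝ}
    {O W : ℝ≥0 → (ℝ≥0 → ℝ) → ℝ} (hκ : 0 < κ) (hρ : -2 < ρ) (hρ0 : ρ ≤ 0)
    (hOW : IsSLEKappaRhoPair κ ρ O W) :
    ∀ᵐ ω ∂preWienerMeasure, Antitone fun t ↦ W t ω - Real.sqrt κ * brownian t ω := by
  filter_upwards [h hκ hρ hOW, SLEKappaRho.ae_snd_eq_of h hκ hρ hOW] with ω hI hW
  intro s t hst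
  dsimp only
  rw [hW t, hW s, add_sub_cancel_left, add_sub_cancel_left]
  refine mul_le_mul_of_nonpos_left ?_ hρ0
  refine intervalIntegral.integral_mono_interval le_rfl (by positivity)
    (by exact_mod_cast hst) (Filter.Eventually.of_forall fun u ↦ ?_) (hI t).1
  exact inv_nonneg.2 (sub_nonneg.2 (hOW.le _ ω))

/-! ### The four stochastic inputs of the second sentence, as explicit hypotheses

Under D-0026 no new named fact is minted here: the four inputs below appear as HYPOTHESES of
the consequences and of the assembly (their statements are repeated verbatim where used):

* (dichotomy) `∀ᵐ ω, PassesLeft (W · ω) i ∨ PassesRight (W · ω) i` — a.s. `w_t → ±∞` as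
  `t ↑ T_i` ([Sch] proof of Thm. 2, "the diffusion (2) is transient", for SLE_κ);
* (sides) `∀ᵐ ω, PassesLeft (W · ω) i ↔ i ∉ F^{ℝ₊}_ℍ(cl K_∞)` — [Sch] Lemma 3 for the hulls of
  SLE(8/3, ρ) ("`γ` is to the left of `z₀` if `lim_{t↑τ(z₀)} w_t = ∞`"; [LSW] p. 38: "`i` ends
  up eventually to 'the right' of the right hand boundary");
* (martingale) for the SLE_{8/3} driving function, `S_{· ∧ ρₙ}` is a martingale for every `n`
  (Schramm's martingale `h(w_u)`, [Sch] proof of Thm. 2, localized as in Rohde–Schramm's proof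
  of Lemma 6.3; the Itô step, drift `(κ/2) h'' + (4w/(1 + w²)) h' = 0` at `κ = 8/3`);
* (comparison) for `−2 < ρ < 0`: the `S_{t ∧ ρₙ}` are integrable and `E S_{t ∧ ρₙ} ≥ 1/2 + c`
  for some `c > 0`, all large `t` and all `n` ([LSW] p. 38, first two sentences, in Schramm's
  coordinates: the extra drift `½ h'(w)(−ρ)/(Z y) dt ≥ 0`). -/

/-! ### Consequences for the SLE_{8/3} driving function -/

/-- At time `0` the stopped observable of the SLE_κ chain is `h(Re z/Im z)` (`W₀ = 0`).
[folklore] -/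
theorem schrammObsStopped_sle_zero (κ : ℝ≥0) {z : ℂ} (hz : 0 < z.im) (n : ℕ) (ω : ℝ≥0 → ℝ) :
    schrammObsStopped (fun s ω ↦ sleDriving κ ω s) z n 0 ω = schrammH (z.re / z.im) := by
  rw [schrammObsStopped_apply]
  have h0 : min ((0 : ℝ≥0) : WithTop ℝ≥0) (Loewner.locTime (fun s ↦ sleDriving κ ω s) z n) = (0 : ℝ≥0) :=
    min_eq_left bot_le
  rw [h0, WithTop.untopA_eq_untop WithTop.coe_ne_top, WithTop.untop_coe]
  rw [Loewner.schrammObs_zero (continuous_sleDriving κ ω) hz]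
  simp [sleDriving_zero]

/-- **Schramm's formula at `z = i` for SLE_{8/3}, localized**: if `S_{· ∧ ρₙ}` is a martingale
(Schramm's martingale), then `E[S_{t ∧ ρₙ}] = S_0 = h(0) = 1/2`.
[cite: Schramm2001Percolation, Thm. 2 (κ = 8/3) and its proof] -/
theorem integral_schrammObsStopped_sle_eq_half {n : ℕ}
    (h : Martingale (schrammObsStopped (fun s ω ↦ sleDriving (8 / 3) ω s) Complex.I n)
      brownianFiltration preWienerMeasure) (t : ℝ≥0) :
    ∫ ω, schrammObsStopped (fun s ω ↦ sleDriving (8 / 3) ω s) Complex.I n t ω ∂preWienerMeasure =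
      1 / 2 := by
  haveI : IsProbabilityMeasure preWienerMeasure := isProbabilityMeasure_preWienerMeasure'
  have hI : 0 < Complex.I.im := by simp
  have h1 := h.setIntegral_eq (zero_le : (0 : ℝ≥0) ≤ t) (s := univ) MeasurableSet.univ
  rw [setIntegral_univ, setIntegral_univ] at h1
  rw [← h1]
  have h2 : (fun ω ↦ schrammObsStopped (fun s ω ↦ sleDriving (8 / 3) ω s) Complex.I n 0 ω) =
      fun _ ↦ (1 / 2 : ℝ) := by
    funext ω
    rw [schrammObsStopped_sle_zero _ hI]
    simp
  rw [h2, integral_const, smul_eq_mul, mul_one_div]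
  simp

/-- **`P[γ passes to the left of i] = 1/2` for SLE_{8/3}** (Schramm's Thm. 2 at `z₀ = i`,
`κ = 8/3`), given Schramm's martingale (`hmart`) and the dichotomy `w_t → ±∞` for the
SLE_{8/3} driving function (`hd`): two dominated-convergence passages
(`measureReal_passesLeft_eq`). [cite: Schramm2001Percolation, Thm. 2 (κ = 8/3)] -/
theorem measureReal_passesLeft_sle_eq_half
    (hd : ∀ᵐ ω ∂preWienerMeasure, Loewner.PassesLeft (fun s ↦ sleDriving (8 / 3) ω s) Complex.I ∨
      Loewner.PassesRight (fun s ↦ sleDriving (8 / 3) ω s) Complex.I)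
    (hmart : ∀ n : ℕ, Martingale (schrammObsStopped (fun s ω ↦ sleDriving (8 / 3) ω s) Complex.I n)
      brownianFiltration preWienerMeasure) :
    preWienerMeasure.real {ω | Loewner.PassesLeft (fun s ↦ sleDriving (8 / 3) ω s) Complex.I} =
      1 / 2 := by
  have hI : 0 < Complex.I.im := by simp
  exact measureReal_passesLeft_eq hI (ae_of_all _ fun ω ↦ continuous_sleDriving _ ω) hd
    (fun n t ↦ ((hmart n).integrable t).aestronglyMeasurable)
    fun t ↦ Eventually.of_forall fun n ↦ integral_schrammObsStopped_sle_eq_half (hmart n) t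

/-! ### Consequences for SLE(κ, ρ) driving pairs -/

section Pairs

variable {ρ : ℝ} {O W O₀ W₀ : ℝ≥0 → (ℝ≥0 → ℝ) → ℝ}

/-- For an SLE(8/3, 0) pair, an almost sure property of the path `s ↦ W₀ s ω` is the same
property of the SLE_{8/3} driving function (Bessel identity, `SLEKappaRho.ae_snd_eq_sleDriving_of`):
here, the dichotomy. [cite: LawlerSchrammWerner2003Restriction, §8.3 (SLE(κ, 0) = SLE_κ)] -/
theorem SLEKappaRho.ae_passes_sleDriving_of (h₁ : SLEKappaRho.integral_inv_eq)
    (h0 : IsSLEKappaRhoPair (8 / 3) 0 O₀ W₀)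
    (hd : ∀ᵐ ω ∂preWienerMeasure, Loewner.PassesLeft (fun s ↦ W₀ s ω) Complex.I ∨
      Loewner.PassesRight (fun s ↦ W₀ s ω) Complex.I) :
    ∀ᵐ ω ∂preWienerMeasure, Loewner.PassesLeft (fun s ↦ sleDriving (8 / 3) ω s) Complex.I ∨
      Loewner.PassesRight (fun s ↦ sleDriving (8 / 3) ω s) Complex.I := by
  filter_upwards [hd, SLEKappaRho.ae_snd_eq_sleDriving_of h₁ (by positivity) h0] with ω hω hω'
  have hω'' : ∀ s, W₀ s ω = sleDriving (8 / 3) ω s := fun s ↦ congrFun hω' s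
  simpa only [hω''] using hω

/-- For an SLE(8/3, 0) pair: if a.s. "`w_t → +∞` iff `i ∉ F^{ℝ₊}_ℍ(cl K_∞)`" (Schramm's
Lemma 3 for its hulls), then `{i ∉ F^{ℝ₊}_ℍ(cl K_∞(W₀))}` is a.e. the left-passage event of the
SLE_{8/3} driving function. [cite: Schramm2001Percolation, Lemma 3] -/
theorem SLEKappaRho.setOf_I_notMem_fill_ae_eq_passesLeft_sle (h₁ : SLEKappaRho.integral_inv_eq)
    (h0 : IsSLEKappaRhoPair (8 / 3) 0 O₀ W₀)
    (hs : ∀ᵐ ω ∂preWienerMeasure,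
      (Loewner.PassesLeft (fun s ↦ W₀ s ω) Complex.I ↔ Complex.I ∉ sleKappaRhoFill W₀ ω)) :
    {ω | Complex.I ∉ sleKappaRhoFill W₀ ω} =ᵐ[preWienerMeasure]
      {ω | Loewner.PassesLeft (fun s ↦ sleDriving (8 / 3) ω s) Complex.I} := by
  filter_upwards [hs, SLEKappaRho.ae_snd_eq_sleDriving_of h₁ (by positivity) h0] with ω hω hω'
  have hω'' : ∀ s, W₀ s ω = sleDriving (8 / 3) ω s := fun s ↦ congrFun hω' s
  simp only [hω''] at hω
  show (Complex.I ∉ sleKappaRhoFill W₀ ω) = Loewner.PassesLeft (fun s ↦ sleDriving (8 / 3) ω s) Complex.I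
  exact propext hω.symm

/-- For any driving process: if a.s. "`w_t → +∞` iff `i ∉ F^{ℝ₊}_ℍ(cl K_∞)`", then the two
events are a.e. equal (hence have the same measure). [cite: Schramm2001Percolation, Lemma 3] -/
theorem SLEKappaRho.setOf_I_notMem_fill_ae_eq_passesLeft
    (hs : ∀ᵐ ω ∂preWienerMeasure,
      (Loewner.PassesLeft (fun s ↦ W s ω) Complex.I ↔ Complex.I ∉ sleKappaRhoFill W ω)) :
    {ω | Complex.I ∉ sleKappaRhoFill W ω} =ᵐ[preWienerMeasure]
      {ω | Loewner.PassesLeft (fun s ↦ W s ω) Complex.I} := by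
  filter_upwards [hs] with ω hω
  show (Complex.I ∉ sleKappaRhoFill W ω) = Loewner.PassesLeft (fun s ↦ W s ω) Complex.I
  exact propext hω.symm

/-- **For `−2 < ρ < 0`, `P[γ passes left of i] > 1/2`** for an SLE(8/3, ρ) pair, given the
dichotomy (`hd`) and the comparison in Schramm's coordinates (`hm`, `hc`: the stopped
observables are integrable and `E S_{t∧ρₙ} ≥ 1/2 + c`); the driving function is a.s. continuous
by the Bessel identity (`h₁`). [cite: LawlerSchrammWerner2003Restriction, proof of Cor. 8.6 (p. 38), first two sentences] -/
theorem SLEKappaRho.half_lt_measureReal_passesLeft (h₁ : SLEKappaRho.integral_inv_eq)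
    (hρ : -2 < ρ) (hOW : IsSLEKappaRhoPair (8 / 3) ρ O W)
    (hd : ∀ᵐ ω ∂preWienerMeasure, Loewner.PassesLeft (fun s ↦ W s ω) Complex.I ∨
      Loewner.PassesRight (fun s ↦ W s ω) Complex.I)
    (hm : ∀ (n : ℕ) (t : ℝ≥0), Integrable (schrammObsStopped W Complex.I n t) preWienerMeasure)
    {c : ℝ} (hc : 0 < c) (hv : ∀ᶠ t : ℝ≥0 in atTop, ∀ n : ℕ,
      1 / 2 + c ≤ ∫ ω, schrammObsStopped W Complex.I n t ω ∂preWienerMeasure) :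
    1 / 2 < preWienerMeasure.real {ω | Loewner.PassesLeft (fun s ↦ W s ω) Complex.I} := by
  have hI : 0 < Complex.I.im := by simp
  have hcW : ∀ᵐ ω ∂preWienerMeasure, Continuous fun s ↦ W s ω :=
    (hOW.ae_continuous h₁ (by positivity) hρ).mono fun ω hω ↦ hω.1
  have h := le_measureReal_passesLeft hI hcW hd (fun n t ↦ (hm n t).aestronglyMeasurable)
    (hv.mono fun t ht ↦ Eventually.of_forall ht)
  linarith

/-- **The comparison of one SLE(8/3, ρ) pair with one SLE(8/3, 0) pair** ([LSW] p. 38, second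
sentence, for the pairs at hand): `P{i ∉ F^{ℝ₊}_ℍ(cl K_∞(W₀))} < P{i ∉ F^{ℝ₊}_ℍ(cl K_∞(W))}`,
given the Bessel identity (`h₁`), the dichotomy and Schramm's Lemma 3 for both pairs
(`hd₀, hs₀, hd, hs`), Schramm's martingale for SLE_{8/3} (`hmart`) and the comparison in
Schramm's coordinates for the SLE(8/3, ρ) pair (`hm`, `hc`, `hv`): the left side is `1/2`, the
right side is `> 1/2`.
[cite: LawlerSchrammWerner2003Restriction, proof of Cor. 8.6 (p. 38), first two sentences] -/
theorem SLEKappaRho.measure_I_notMem_fill_lt_of_schramm (h₁ : SLEKappaRho.integral_inv_eq)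
    (hρ : -2 < ρ) (hOW : IsSLEKappaRhoPair (8 / 3) ρ O W) (h0 : IsSLEKappaRhoPair (8 / 3) 0 O₀ W₀)
    (hd₀ : ∀ᵐ ω ∂preWienerMeasure, Loewner.PassesLeft (fun s ↦ W₀ s ω) Complex.I ∨
      Loewner.PassesRight (fun s ↦ W₀ s ω) Complex.I)
    (hs₀ : ∀ᵐ ω ∂preWienerMeasure,
      (Loewner.PassesLeft (fun s ↦ W₀ s ω) Complex.I ↔ Complex.I ∉ sleKappaRhoFill W₀ ω))
    (hd : ∀ᵐ ω ∂preWienerMeasure, Loewner.PassesLeft (fun s ↦ W s ω) Complex.I ∨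
      Loewner.PassesRight (fun s ↦ W s ω) Complex.I)
    (hs : ∀ᵐ ω ∂preWienerMeasure,
      (Loewner.PassesLeft (fun s ↦ W s ω) Complex.I ↔ Complex.I ∉ sleKappaRhoFill W ω))
    (hmart : ∀ n : ℕ, Martingale (schrammObsStopped (fun s ω ↦ sleDriving (8 / 3) ω s) Complex.I n)
      brownianFiltration preWienerMeasure)
    (hm : ∀ (n : ℕ) (t : ℝ≥0), Integrable (schrammObsStopped W Complex.I n t) preWienerMeasure)
    {c : ℝ} (hc : 0 < c) (hv : ∀ᶠ t : ℝ≥0 in atTop, ∀ n : ℕ,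
      1 / 2 + c ≤ ∫ ω, schrammObsStopped W Complex.I n t ω ∂preWienerMeasure) :
    preWienerMeasure {ω | Complex.I ∉ sleKappaRhoFill W₀ ω} <
      preWienerMeasure {ω | Complex.I ∉ sleKappaRhoFill W ω} := by
  haveI : IsProbabilityMeasure preWienerMeasure := isProbabilityMeasure_preWienerMeasure'
  rw [measure_congr (SLEKappaRho.setOf_I_notMem_fill_ae_eq_passesLeft_sle h₁ h0 hs₀),
    measure_congr (SLEKappaRho.setOf_I_notMem_fill_ae_eq_passesLeft hs),
    ← ofReal_measureReal (measure_ne_top _ _), ← ofReal_measureReal (measure_ne_top _ _),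
    measureReal_passesLeft_sle_eq_half (SLEKappaRho.ae_passes_sleDriving_of h₁ h0 hd₀) hmart]
  have h := SLEKappaRho.half_lt_measureReal_passesLeft h₁ hρ hOW hd hm hc hv
  exact (ENNReal.ofReal_lt_ofReal_iff (by linarith)).2 h

end Pairs

/-! ### The assembly: the named facts of `SLEKappaRho` / `SLEKappaRhoAsymmetry` from the four inputs -/

/-- **[LSW] p. 38, second sentence, from its inputs**: the named fact
`SLEKappaRho.measure_I_notMem_fill_lt_of_neg` (`SLEKappaRhoAsymmetry`) follows from the
integrated Bessel equation of §8.3 (`SLEKappaRho.integral_inv_eq`) and the four stochastic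
inputs, each quantified over the SLE(8/3, ρ) driving pairs concerned: the dichotomy `w_t → ±∞`
(`h₂`, `−2 < ρ ≤ 0`), Schramm's Lemma 3 for SLE(8/3, ρ) (`h₃`, `−2 < ρ ≤ 0`), Schramm's
martingale for SLE_{8/3} (`h₄`) and the comparison in Schramm's coordinates (`h₅`, `−2 < ρ < 0`).
[cite: LawlerSchrammWerner2003Restriction, proof of Cor. 8.6 (p. 38), first two sentences] -/
theorem SLEKappaRho.measure_I_notMem_fill_lt_of_neg_of_schramm (h₁ : SLEKappaRho.integral_inv_eq)
    (h₂ : ∀ {ρ : ℝ} {O W : ℝ≥0 → (ℝ≥0 → ℝ) → ℝ}, -2 < ρ → ρ ≤ 0 → IsSLEKappaRhoPair (8 / 3) ρ O W →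
      ∀ᵐ ω ∂preWienerMeasure, Loewner.PassesLeft (fun s ↦ W s ω) Complex.I ∨
        Loewner.PassesRight (fun s ↦ W s ω) Complex.I)
    (h₃ : ∀ {ρ : ℝ} {O W : ℝ≥0 → (ℝ≥0 → ℝ) → ℝ}, -2 < ρ → ρ ≤ 0 → IsSLEKappaRhoPair (8 / 3) ρ O W →
      ∀ᵐ ω ∂preWienerMeasure,
        (Loewner.PassesLeft (fun s ↦ W s ω) Complex.I ↔ Complex.I ∉ sleKappaRhoFill W ω))
    (h₄ : ∀ n : ℕ, Martingale (schrammObsStopped (fun s ω ↦ sleDriving (8 / 3) ω s) Complex.I n)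
      brownianFiltration preWienerMeasure)
    (h₅ : ∀ {ρ : ℝ} {O W : ℝ≥0 → (ℝ≥0 → ℝ) → ℝ}, -2 < ρ → ρ < 0 → IsSLEKappaRhoPair (8 / 3) ρ O W →
      (∀ (n : ℕ) (t : ℝ≥0), Integrable (schrammObsStopped W Complex.I n t) preWienerMeasure) ∧
        ∃ c : ℝ, 0 < c ∧ ∀ᶠ t : ℝ≥0 in atTop, ∀ n : ℕ,
          1 / 2 + c ≤ ∫ ω, schrammObsStopped W Complex.I n t ω ∂preWienerMeasure) :
    SLEKappaRho.measure_I_notMem_fill_lt_of_neg := by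
  intro ρ O W O₀ W₀ hρ hρ0 hOW h0
  obtain ⟨hm, c, hc, hv⟩ := h₅ hρ hρ0 hOW
  exact SLEKappaRho.measure_I_notMem_fill_lt_of_schramm h₁ hρ hOW h0 (h₂ (by norm_num) le_rfl h0)
    (h₃ (by norm_num) le_rfl h0) (h₂ hρ hρ0.le hOW) (h₃ hρ hρ0.le hOW) h₄ hm hc hv

/-- The same inputs minus Schramm's martingale give the bundled p. 38 fact of `SLEKappaRho`,
`SLEKappaRho.one_half_lt_measure_I_notMem_fill` (`P{i ∉ F^{ℝ₊}_ℍ(cl K_∞)} > 1/2` for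
`−2 < ρ < 0`), which involves no SLE(8/3, 0) pair.
[cite: LawlerSchrammWerner2003Restriction, proof of Cor. 8.6 (p. 38), first two sentences] -/
theorem SLEKappaRho.one_half_lt_measure_I_notMem_fill_of_schramm (h₁ : SLEKappaRho.integral_inv_eq)
    (h₂ : ∀ {ρ : ℝ} {O W : ℝ≥0 → (ℝ≥0 → ℝ) → ℝ}, -2 < ρ → ρ < 0 → IsSLEKappaRhoPair (8 / 3) ρ O W →
      ∀ᵐ ω ∂preWienerMeasure, Loewner.PassesLeft (fun s ↦ W s ω) Complex.I ∨
        Loewner.PassesRight (fun s ↦ W s ω) Complex.I)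
    (h₃ : ∀ {ρ : ℝ} {O W : ℝ≥0 → (ℝ≥0 → ℝ) → ℝ}, -2 < ρ → ρ < 0 → IsSLEKappaRhoPair (8 / 3) ρ O W →
      ∀ᵐ ω ∂preWienerMeasure,
        (Loewner.PassesLeft (fun s ↦ W s ω) Complex.I ↔ Complex.I ∉ sleKappaRhoFill W ω))
    (h₅ : ∀ {ρ : ℝ} {O W : ℝ≥0 → (ℝ≥0 → ℝ) → ℝ}, -2 < ρ → ρ < 0 → IsSLEKappaRhoPair (8 / 3) ρ O W →
      (∀ (n : ℕ) (t : ℝ≥0), Integrable (schrammObsStopped W Complex.I n t) preWienerMeasure) ∧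
        ∃ c : ℝ, 0 < c ∧ ∀ᶠ t : ℝ≥0 in atTop, ∀ n : ℕ,
          1 / 2 + c ≤ ∫ ω, schrammObsStopped W Complex.I n t ω ∂preWienerMeasure) :
    SLEKappaRho.one_half_lt_measure_I_notMem_fill := by
  intro ρ O W hρ hρ0 hOW
  haveI : IsProbabilityMeasure preWienerMeasure := isProbabilityMeasure_preWienerMeasure'
  obtain ⟨hm, c, hc, hv⟩ := h₅ hρ hρ0 hOW
  rw [measure_congr (SLEKappaRho.setOf_I_notMem_fill_ae_eq_passesLeft (h₃ hρ hρ0 hOW)),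
    ← ofReal_measureReal (measure_ne_top _ _)]
  have h := SLEKappaRho.half_lt_measureReal_passesLeft h₁ hρ hOW (h₂ hρ hρ0 hOW) hm hc hv
  rw [show (1 / 2 : ℝ≥0∞) = ENNReal.ofReal (1 / 2) by
    rw [ENNReal.ofReal_div_of_pos two_pos, ENNReal.ofReal_one, ENNReal.ofReal_ofNat]]
  exact (ENNReal.ofReal_lt_ofReal_iff (by linarith)).2 h

/-- **The symmetry sentence from Schramm's formula**: the dichotomy and Schramm's Lemma 3 for
SLE(8/3, 0) pairs together with Schramm's martingale give the named fact
`SLEKappaRho.measure_I_notMem_fill_eq_half` of `SLEKappaRhoAsymmetry` ("which is `1/2` by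
symmetry", here from Schramm's Thm. 2 at `z₀ = i` rather than the reflection argument).
[cite: LawlerSchrammWerner2003Restriction, proof of Cor. 8.6 (p. 38), second sentence; Schramm2001Percolation, Thm. 2 (κ = 8/3)] -/
theorem SLEKappaRho.measure_I_notMem_fill_eq_half_of_schramm (h₁ : SLEKappaRho.integral_inv_eq)
    (h₂ : ∀ {O W : ℝ≥0 → (ℝ≥0 → ℝ) → ℝ}, IsSLEKappaRhoPair (8 / 3) 0 O W →
      ∀ᵐ ω ∂preWienerMeasure, Loewner.PassesLeft (fun s ↦ W s ω) Complex.I ∨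
        Loewner.PassesRight (fun s ↦ W s ω) Complex.I)
    (h₃ : ∀ {O W : ℝ≥0 → (ℝ≥0 → ℝ) → ℝ}, IsSLEKappaRhoPair (8 / 3) 0 O W →
      ∀ᵐ ω ∂preWienerMeasure,
        (Loewner.PassesLeft (fun s ↦ W s ω) Complex.I ↔ Complex.I ∉ sleKappaRhoFill W ω))
    (h₄ : ∀ n : ℕ, Martingale (schrammObsStopped (fun s ω ↦ sleDriving (8 / 3) ω s) Complex.I n)
      brownianFiltration preWienerMeasure) :
    SLEKappaRho.measure_I_notMem_fill_eq_half := by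
  intro O₀ W₀ h0
  haveI : IsProbabilityMeasure preWienerMeasure := isProbabilityMeasure_preWienerMeasure'
  rw [measure_congr (SLEKappaRho.setOf_I_notMem_fill_ae_eq_passesLeft_sle h₁ h0 (h₃ h0)),
    ← ofReal_measureReal (measure_ne_top _ _),
    measureReal_passesLeft_sle_eq_half (SLEKappaRho.ae_passes_sleDriving_of h₁ h0 (h₂ h0)) h₄,
    ENNReal.ofReal_div_of_pos two_pos, ENNReal.ofReal_one, ENNReal.ofReal_ofNat]

end Literature.Probability.RandomPlanarGeometry

end
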